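import Summits.RiemannHypothesis.RiemannHypothesis.Theorems.JensenPolynomialsTruncatedBinomialTwoBranch

/-!
# Route `JensenPolynomials`, FAR crux `XiWindowZeroFreeRelFar` (B1-rel) — the truncated binomial series, IV: the two-branch
bound with the GEOMETRIC segment term (RH-FREE; cell rh-jensen, HUMAN RULING D-0040; helper for stub S2 `stub_junk` of item
`stmt-RiemannHypothesis-19465`)

Part III bounds the segment integral `I_M(r) = ∫₀^r x^M(1+x)^{−M−½}dx` by `r^{M+1}/(M+1)`, which is useless for `r = |w| > 1`
(the band `0.4υ ≤ u ≤ √|a|` of S2 has `|w| = |a|/u²` up to `2.2`). Since `x^M(1+x)^{−M−½} = (x/(1+x))^M(1+x)^{−½} ≤ (r/(1+r))^M`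
on `[0, r]`, also `I_M(r) ≤ r·(r/(1+r))^M` (`segInt_le_geom`), and the two-branch bound holds with the first term
`‖1+w‖^{M−½}·½C·r·(r/(1+r))^M` (`norm_truncBinom_sub_cpow_le_geom`): multiplied by `u^{2M}` this is
`u|u²+a|^{M−½}·½C·r·(|a|/(u²+|a|))^M ≤ ½C·|a|^{M+1}u^{−2}` — endpoint scale, like the arc term.

WHAT THIS IS NOT: elementary analysis of a polynomial; nothing here bears on the zeros of `ζ` or the truth of RH.
References: Szegő 1924; [GORZPNAS2019].
-/

noncomputable section
-- D-0017: `Summit.RiemannHypothesis.RiemannHypothesis.…` duplicates the namespace BY DESIGN (single-problem summit).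
set_option linter.dupNamespace false

namespace Summit.RiemannHypothesis.RiemannHypothesis.Theorems.JensenPolynomials.WindowEGF

open Complex MeasureTheory Set Filter Finset
open scoped Real Topology ComplexConjugate

/-- **Geometric segment bound**: `∫₀^r x^M(1+x)^{−(M−½)−1}dx ≤ r·(r/(1+r))^M` for `r ≥ 0`. -/
theorem segInt_le_geom (M : ℕ) {r : ℝ} (hr : 0 ≤ r) :
    (∫ x in (0 : ℝ)..r, x ^ M * (1 + x) ^ (-(((M : ℝ) - 1 / 2)) - 1)) ≤ r * (r / (1 + r)) ^ M := by
  have hpt : ∀ x ∈ Set.Icc (0 : ℝ) r, x ^ M * (1 + x) ^ (-(((M : ℝ) - 1 / 2)) - 1) ≤ (r / (1 + r)) ^ M := by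
    intro x hx
    have hx0 : 0 ≤ x := hx.1
    have h1x : 0 < 1 + x := by linarith
    have hsplit : (1 + x) ^ (-(((M : ℝ) - 1 / 2)) - 1) = ((1 + x) ^ M)⁻¹ * (1 + x) ^ (-(1 / 2 : ℝ)) := by
      rw [show (-(((M : ℝ) - 1 / 2)) - 1) = (-(M : ℝ)) + (-(1 / 2 : ℝ)) by ring, Real.rpow_add h1x,
        Real.rpow_neg h1x.le, Real.rpow_natCast]
    have hhalf : (1 + x) ^ (-(1 / 2 : ℝ)) ≤ 1 :=
      Real.rpow_le_one_of_one_le_of_nonpos (by linarith) (by norm_num)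
    have hfrac : x / (1 + x) ≤ r / (1 + r) := by
      rw [div_le_div_iff₀ h1x (by linarith)]; nlinarith [hx.2]
    calc x ^ M * (1 + x) ^ (-(((M : ℝ) - 1 / 2)) - 1)
        = (x / (1 + x)) ^ M * (1 + x) ^ (-(1 / 2 : ℝ)) := by rw [hsplit, div_pow]; ring
      _ ≤ (x / (1 + x)) ^ M * 1 := by
          apply mul_le_mul_of_nonneg_left hhalf (pow_nonneg (div_nonneg hx0 h1x.le) _)
      _ ≤ (r / (1 + r)) ^ M := by
          rw [mul_one]; exact pow_le_pow_left₀ (div_nonneg hx0 h1x.le) hfrac M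
  have hcont : ContinuousOn (fun x : ℝ ↦ x ^ M * (1 + x) ^ (-(((M : ℝ) - 1 / 2)) - 1)) (Set.uIcc 0 r) := by
    rw [Set.uIcc_of_le hr]
    intro x hx
    have h1x : (1 + x) ≠ 0 := by have := hx.1; intro h; linarith
    exact ((continuousAt_id.pow M).mul
      ((continuousAt_const.add continuousAt_id).rpow_const (Or.inl h1x))).continuousWithinAt
  calc (∫ x in (0 : ℝ)..r, x ^ M * (1 + x) ^ (-(((M : ℝ) - 1 / 2)) - 1))
      ≤ ∫ x in (0 : ℝ)..r, (r / (1 + r)) ^ M :=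
        intervalIntegral.integral_mono_on hr hcont.intervalIntegrable intervalIntegrable_const hpt
    _ = r * (r / (1 + r)) ^ M := by rw [intervalIntegral.integral_const]; simp

/-- **Two-branch bound, arc form, geometric segment term.** For `M ≥ 1`, `r > 0`, `0 ≤ α ≤ π` and `w = r e^{iα} ≠ −1`:
`‖T_M(w) − (1+w)^{M−½}‖ ≤ ‖1+w‖^{M−½}·binom(M−½,M) r^{M+1}/(2(M+1)) + ½binom(M−½,M) r^{M+1}·∫₀^α dβ/‖1 + re^{iβ}‖`. -/
theorem norm_truncBinom_sub_cpow_le_arc_geom (M : ℕ) (hM : 1 ≤ M) {r α : ℝ} (hr : 0 < r) (hα0 : 0 ≤ α)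
    (hαπ : α ≤ π) (hw : 1 + ((r : ℂ) * Complex.exp ((α : ℂ) * I)) ≠ 0) :
    ‖(∑ k ∈ Finset.range (M + 1), ((((descPochhammer ℝ k).eval ((M : ℝ) - 1 / 2) / (Nat.factorial k : ℝ)) : ℝ) : ℂ) * (((r : ℂ) * Complex.exp ((α : ℂ) * I))) ^ k) - (1 + ((r : ℂ) * Complex.exp ((α : ℂ) * I))) ^ ((((M : ℝ) - 1 / 2) : ℝ) : ℂ)‖ ≤
      ‖1 + ((r : ℂ) * Complex.exp ((α : ℂ) * I))‖ ^ (((M : ℝ) - 1 / 2)) * (((descPochhammer ℝ M).eval ((M : ℝ) - 1 / 2) / (Nat.factorial M : ℝ)) / 2 * (r * (r / (1 + r)) ^ M)) +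
        ((descPochhammer ℝ M).eval ((M : ℝ) - 1 / 2) / (Nat.factorial M : ℝ)) / 2 * r ^ (M + 1) * ∫ β in (0 : ℝ)..α, ‖1 + ((r : ℂ) * Complex.exp ((β : ℂ) * I))‖⁻¹ := by
  have hN0 : 0 ≤ ((M : ℝ) - 1 / 2) := by
    have : (1 : ℝ) ≤ M := by exact_mod_cast hM
    linarith
  have hC0 : 0 ≤ ((descPochhammer ℝ M).eval ((M : ℝ) - 1 / 2) / (Nat.factorial M : ℝ)) / 2 := by have := halfBinom_pos (le_refl M); positivity
  have hCr : 0 ≤ ((descPochhammer ℝ M).eval ((M : ℝ) - 1 / 2) / (Nat.factorial M : ℝ)) / 2 * r ^ (M + 1) := mul_nonneg hC0 (pow_nonneg hr.le _)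
  -- the two functions along the arc
  set h : ℝ → ℂ := fun β ↦ ((∑ k ∈ Finset.range (M + 1), ((((descPochhammer ℝ k).eval ((M : ℝ) - 1 / 2) / (Nat.factorial k : ℝ)) : ℝ) : ℂ) * (((r : ℂ) * Complex.exp ((β : ℂ) * I))) ^ k) * (1 + (((r : ℂ) * Complex.exp ((β : ℂ) * I)))) ^ (-((((M : ℝ) - 1 / 2) : ℝ) : ℂ))) with hhdef
  set h' : ℝ → ℂ := fun β ↦ (((((descPochhammer ℝ M).eval ((M : ℝ) - 1 / 2) / (Nat.factorial M : ℝ)) / 2 : ℝ) : ℂ) * (((r : ℂ) * Complex.exp ((β : ℂ) * I))) ^ M * (1 + (((r : ℂ) * Complex.exp ((β : ℂ) * I)))) ^ (-((((M : ℝ) - 1 / 2) : ℝ) : ℂ) - 1)) * (((r : ℂ) * Complex.exp ((β : ℂ) * I)) * I) with hh'def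
  -- nonvanishing of `1 + r e^{iβ}` along the arc
  have hwpos : 0 < ‖1 + ((r : ℂ) * Complex.exp ((α : ℂ) * I))‖ := norm_pos_iff.mpr hw
  have hne : ∀ β ∈ Set.Icc 0 α, 1 + ((r : ℂ) * Complex.exp ((β : ℂ) * I)) ≠ 0 := by
    intro β hβ
    have hle := norm_one_add_arcPt_anti hr.le hβ.1 hβ.2 hαπ
    exact norm_pos_iff.mp (lt_of_lt_of_le hwpos hle)
  -- continuity of h, h' on [0, α]
  have hcont : ContinuousOn h (Set.Icc 0 α) :=
    ((continuous_truncBinom M).comp (continuous_arcPt r)).continuousOn.mul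
      (continuousOn_cpow_one_add_arcPt hr.le hαπ hne _)
  have hcont' : ContinuousOn h' (Set.Icc 0 α) := by
    apply ContinuousOn.mul
    · apply ContinuousOn.mul
      · exact (continuous_const.mul ((continuous_arcPt r).pow M)).continuousOn
      · exact continuousOn_cpow_one_add_arcPt hr.le hαπ hne _
    · exact ((continuous_arcPt r).mul continuous_const).continuousOn
  -- the derivative at interior points
  have hderiv : ∀ β ∈ Set.Ioo 0 α, HasDerivAt h (h' β) β := by
    intro β hβ
    have hslit : 1 + ((r : ℂ) * Complex.exp ((β : ℂ) * I)) ∈ slitPlane :=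
      one_add_arcPt_mem_slitPlane hr hβ.1 (lt_of_lt_of_le hβ.2 hαπ)
    exact (hasDerivAt_truncBinomG M hslit).comp β (hasDerivAt_arcPt r β)
  have hIcc : Set.uIcc (0 : ℝ) α = Set.Icc 0 α := Set.uIcc_of_le hα0
  have hint : IntervalIntegrable h' volume 0 α := by
    apply ContinuousOn.intervalIntegrable
    rw [hIcc]; exact hcont'
  have hftc : ∫ β in (0 : ℝ)..α, h' β = h α - h 0 :=
    intervalIntegral.integral_eq_sub_of_hasDerivAt_of_le hα0 hcont hderiv hint
  -- the norm of h'
  have hnorm' : ∀ β, ‖h' β‖ = ((descPochhammer ℝ M).eval ((M : ℝ) - 1 / 2) / (Nat.factorial M : ℝ)) / 2 * r ^ (M + 1) * ‖1 + ((r : ℂ) * Complex.exp ((β : ℂ) * I))‖ ^ (-(((M : ℝ) - 1 / 2)) - 1) := by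
    intro β
    simp only [hh'def]
    rw [norm_mul, norm_truncBinomG', norm_arcPt hr.le, norm_mul, norm_arcPt hr.le, Complex.norm_I, mul_one]
    ring
  -- pointwise comparison on [0, α]
  have hpt : ∀ β ∈ Set.Icc 0 α, ‖1 + ((r : ℂ) * Complex.exp ((α : ℂ) * I))‖ ^ (((M : ℝ) - 1 / 2)) * ‖h' β‖ ≤
      ((descPochhammer ℝ M).eval ((M : ℝ) - 1 / 2) / (Nat.factorial M : ℝ)) / 2 * r ^ (M + 1) * ‖1 + ((r : ℂ) * Complex.exp ((β : ℂ) * I))‖⁻¹ := by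
    intro β hβ
    rw [hnorm' β]
    have hm : ‖1 + ((r : ℂ) * Complex.exp ((α : ℂ) * I))‖ ≤ ‖1 + ((r : ℂ) * Complex.exp ((β : ℂ) * I))‖ := norm_one_add_arcPt_anti hr.le hβ.1 hβ.2 hαπ
    have hmpos : 0 < ‖1 + ((r : ℂ) * Complex.exp ((β : ℂ) * I))‖ := lt_of_lt_of_le hwpos hm
    have h1 : ‖1 + ((r : ℂ) * Complex.exp ((α : ℂ) * I))‖ ^ (((M : ℝ) - 1 / 2)) ≤ ‖1 + ((r : ℂ) * Complex.exp ((β : ℂ) * I))‖ ^ (((M : ℝ) - 1 / 2)) :=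
      Real.rpow_le_rpow (norm_nonneg _) hm hN0
    have h2 : ‖1 + ((r : ℂ) * Complex.exp ((β : ℂ) * I))‖ ^ (((M : ℝ) - 1 / 2)) * ‖1 + ((r : ℂ) * Complex.exp ((β : ℂ) * I))‖ ^ (-(((M : ℝ) - 1 / 2)) - 1) = ‖1 + ((r : ℂ) * Complex.exp ((β : ℂ) * I))‖⁻¹ := by
      rw [← Real.rpow_add hmpos, show ((M : ℝ) - 1 / 2) + (-(((M : ℝ) - 1 / 2)) - 1) = -1 by ring, Real.rpow_neg_one]
    have h3 : 0 ≤ ‖1 + ((r : ℂ) * Complex.exp ((β : ℂ) * I))‖ ^ (-(((M : ℝ) - 1 / 2)) - 1) := Real.rpow_nonneg (norm_nonneg _) _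
    calc ‖1 + ((r : ℂ) * Complex.exp ((α : ℂ) * I))‖ ^ (((M : ℝ) - 1 / 2)) * (((descPochhammer ℝ M).eval ((M : ℝ) - 1 / 2) / (Nat.factorial M : ℝ)) / 2 * r ^ (M + 1) * ‖1 + ((r : ℂ) * Complex.exp ((β : ℂ) * I))‖ ^ (-(((M : ℝ) - 1 / 2)) - 1))
        = (((descPochhammer ℝ M).eval ((M : ℝ) - 1 / 2) / (Nat.factorial M : ℝ)) / 2 * r ^ (M + 1)) * (‖1 + ((r : ℂ) * Complex.exp ((α : ℂ) * I))‖ ^ (((M : ℝ) - 1 / 2)) * ‖1 + ((r : ℂ) * Complex.exp ((β : ℂ) * I))‖ ^ (-(((M : ℝ) - 1 / 2)) - 1)) := by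
          ring
      _ ≤ (((descPochhammer ℝ M).eval ((M : ℝ) - 1 / 2) / (Nat.factorial M : ℝ)) / 2 * r ^ (M + 1)) * (‖1 + ((r : ℂ) * Complex.exp ((β : ℂ) * I))‖ ^ (((M : ℝ) - 1 / 2)) * ‖1 + ((r : ℂ) * Complex.exp ((β : ℂ) * I))‖ ^ (-(((M : ℝ) - 1 / 2)) - 1)) := by
          gcongr
      _ = ((descPochhammer ℝ M).eval ((M : ℝ) - 1 / 2) / (Nat.factorial M : ℝ)) / 2 * r ^ (M + 1) * ‖1 + ((r : ℂ) * Complex.exp ((β : ℂ) * I))‖⁻¹ := by rw [h2]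
  -- integrability of the comparison functions
  have hJcont : ContinuousOn (fun β : ℝ ↦ ‖1 + ((r : ℂ) * Complex.exp ((β : ℂ) * I))‖⁻¹) (Set.Icc 0 α) := by
    intro β hβ
    have hc : ContinuousAt (fun b : ℝ ↦ ‖1 + ((r : ℂ) * Complex.exp ((b : ℂ) * I))‖) β :=
      ((continuous_const.add (continuous_arcPt r)).norm).continuousAt
    exact (hc.inv₀ (norm_ne_zero_iff.mpr (hne β hβ))).continuousWithinAt
  have hJint : IntervalIntegrable (fun β : ℝ ↦ ‖1 + ((r : ℂ) * Complex.exp ((β : ℂ) * I))‖⁻¹) volume 0 α := by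
    apply ContinuousOn.intervalIntegrable; rw [hIcc]; exact hJcont
  have hnint : IntervalIntegrable (fun β : ℝ ↦ ‖h' β‖) volume 0 α := hint.norm
  -- the integral comparison
  have hI1 : ‖1 + ((r : ℂ) * Complex.exp ((α : ℂ) * I))‖ ^ (((M : ℝ) - 1 / 2)) * ∫ β in (0 : ℝ)..α, ‖h' β‖ ≤
      ((descPochhammer ℝ M).eval ((M : ℝ) - 1 / 2) / (Nat.factorial M : ℝ)) / 2 * r ^ (M + 1) * ∫ β in (0 : ℝ)..α, ‖1 + ((r : ℂ) * Complex.exp ((β : ℂ) * I))‖⁻¹ := by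
    rw [← intervalIntegral.integral_const_mul, ← intervalIntegral.integral_const_mul]
    apply intervalIntegral.integral_mono_on hα0 (hnint.const_mul _) (hJint.const_mul _)
    intro β hβ
    exact hpt β hβ
  -- h 0 = G(r) = 1 + C/2 I_r
  have hh0 : h 0 = 1 + (((((descPochhammer ℝ M).eval ((M : ℝ) - 1 / 2) / (Nat.factorial M : ℝ)) / 2) * (∫ x in (0 : ℝ)..r, x ^ M * (1 + x) ^ (-(((M : ℝ) - 1 / 2)) - 1)) : ℝ) : ℂ) := by
    simp only [hhdef, Complex.ofReal_zero, zero_mul, Complex.exp_zero, mul_one]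
    exact truncBinomG_ofReal M hr.le
  obtain ⟨hI0, -⟩ := segInt_bounds M hr.le
  have hIle := segInt_le_geom M hr.le
  -- T w = h α · (1+w)^N
  have hTw : (∑ k ∈ Finset.range (M + 1), ((((descPochhammer ℝ k).eval ((M : ℝ) - 1 / 2) / (Nat.factorial k : ℝ)) : ℝ) : ℂ) * (((r : ℂ) * Complex.exp ((α : ℂ) * I))) ^ k) = h α * (1 + ((r : ℂ) * Complex.exp ((α : ℂ) * I))) ^ ((((M : ℝ) - 1 / 2) : ℝ) : ℂ) := by
    simp only [hhdef]
    rw [mul_assoc, ← Complex.cpow_add _ _ hw, neg_add_cancel, Complex.cpow_zero, mul_one]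
  have hPnorm : ‖(1 + ((r : ℂ) * Complex.exp ((α : ℂ) * I))) ^ ((((M : ℝ) - 1 / 2) : ℝ) : ℂ)‖ = ‖1 + ((r : ℂ) * Complex.exp ((α : ℂ) * I))‖ ^ (((M : ℝ) - 1 / 2)) :=
    Complex.norm_cpow_real _ _
  -- assemble
  have hsplit : (∑ k ∈ Finset.range (M + 1), ((((descPochhammer ℝ k).eval ((M : ℝ) - 1 / 2) / (Nat.factorial k : ℝ)) : ℝ) : ℂ) * (((r : ℂ) * Complex.exp ((α : ℂ) * I))) ^ k) - (1 + ((r : ℂ) * Complex.exp ((α : ℂ) * I))) ^ ((((M : ℝ) - 1 / 2) : ℝ) : ℂ) =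
      ((h α - h 0) + (h 0 - 1)) * (1 + ((r : ℂ) * Complex.exp ((α : ℂ) * I))) ^ ((((M : ℝ) - 1 / 2) : ℝ) : ℂ) := by
    rw [hTw]; ring
  have hA : ‖h α - h 0‖ ≤ ∫ β in (0 : ℝ)..α, ‖h' β‖ := by
    rw [← hftc]
    exact intervalIntegral.norm_integral_le_integral_norm hα0
  have hB : ‖h 0 - 1‖ = ((descPochhammer ℝ M).eval ((M : ℝ) - 1 / 2) / (Nat.factorial M : ℝ)) / 2 * (∫ x in (0 : ℝ)..r, x ^ M * (1 + x) ^ (-(((M : ℝ) - 1 / 2)) - 1)) := by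
    rw [hh0, add_sub_cancel_left, Complex.norm_real, Real.norm_of_nonneg (mul_nonneg hC0 hI0)]
  calc ‖(∑ k ∈ Finset.range (M + 1), ((((descPochhammer ℝ k).eval ((M : ℝ) - 1 / 2) / (Nat.factorial k : ℝ)) : ℝ) : ℂ) * (((r : ℂ) * Complex.exp ((α : ℂ) * I))) ^ k) - (1 + ((r : ℂ) * Complex.exp ((α : ℂ) * I))) ^ ((((M : ℝ) - 1 / 2) : ℝ) : ℂ)‖
      = ‖((h α - h 0) + (h 0 - 1)) * (1 + ((r : ℂ) * Complex.exp ((α : ℂ) * I))) ^ ((((M : ℝ) - 1 / 2) : ℝ) : ℂ)‖ := by rw [hsplit]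
    _ ≤ (‖h α - h 0‖ + ‖h 0 - 1‖) * ‖1 + ((r : ℂ) * Complex.exp ((α : ℂ) * I))‖ ^ (((M : ℝ) - 1 / 2)) := by
        rw [norm_mul, hPnorm]
        gcongr
        exact norm_add_le _ _
    _ ≤ ((∫ β in (0 : ℝ)..α, ‖h' β‖) + ((descPochhammer ℝ M).eval ((M : ℝ) - 1 / 2) / (Nat.factorial M : ℝ)) / 2 * (∫ x in (0 : ℝ)..r, x ^ M * (1 + x) ^ (-(((M : ℝ) - 1 / 2)) - 1))) * ‖1 + ((r : ℂ) * Complex.exp ((α : ℂ) * I))‖ ^ (((M : ℝ) - 1 / 2)) := by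
        rw [hB]; gcongr
    _ = ‖1 + ((r : ℂ) * Complex.exp ((α : ℂ) * I))‖ ^ (((M : ℝ) - 1 / 2)) * (((descPochhammer ℝ M).eval ((M : ℝ) - 1 / 2) / (Nat.factorial M : ℝ)) / 2 * (∫ x in (0 : ℝ)..r, x ^ M * (1 + x) ^ (-(((M : ℝ) - 1 / 2)) - 1))) +
          ‖1 + ((r : ℂ) * Complex.exp ((α : ℂ) * I))‖ ^ (((M : ℝ) - 1 / 2)) * ∫ β in (0 : ℝ)..α, ‖h' β‖ := by ring
    _ ≤ ‖1 + ((r : ℂ) * Complex.exp ((α : ℂ) * I))‖ ^ (((M : ℝ) - 1 / 2)) * (((descPochhammer ℝ M).eval ((M : ℝ) - 1 / 2) / (Nat.factorial M : ℝ)) / 2 * (r * (r / (1 + r)) ^ M)) +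
          ((descPochhammer ℝ M).eval ((M : ℝ) - 1 / 2) / (Nat.factorial M : ℝ)) / 2 * r ^ (M + 1) * ∫ β in (0 : ℝ)..α, ‖1 + ((r : ℂ) * Complex.exp ((β : ℂ) * I))‖⁻¹ := by
        gcongr


/-- **Two-branch bound, general form, geometric segment term.** For `M ≥ 1` and `w ∉ {0, −1}`, with `r = ‖w‖`:
`‖T_M(w) − (1+w)^{M−½}‖ ≤ ‖1+w‖^{M−½}·binom(M−½,M) r^{M+1}/(2(M+1)) + ½binom(M−½,M) r^{M+1}·∫₀^{|arg w|} dβ/‖1+re^{iβ}‖`.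
-/
theorem norm_truncBinom_sub_cpow_le_geom (M : ℕ) (hM : 1 ≤ M) {w : ℂ} (hw0 : w ≠ 0) (hw1 : 1 + w ≠ 0) :
    ‖(∑ k ∈ Finset.range (M + 1), ((((descPochhammer ℝ k).eval ((M : ℝ) - 1 / 2) / (Nat.factorial k : ℝ)) : ℝ) : ℂ) * w ^ k) - (1 + w) ^ ((((M : ℝ) - 1 / 2) : ℝ) : ℂ)‖ ≤
      ‖1 + w‖ ^ (((M : ℝ) - 1 / 2)) * (((descPochhammer ℝ M).eval ((M : ℝ) - 1 / 2) / (Nat.factorial M : ℝ)) / 2 * (‖w‖ * (‖w‖ / (1 + ‖w‖)) ^ M)) +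
        ((descPochhammer ℝ M).eval ((M : ℝ) - 1 / 2) / (Nat.factorial M : ℝ)) / 2 * ‖w‖ ^ (M + 1) * ∫ β in (0 : ℝ)..|arg w|, ‖1 + ((‖w‖ : ℂ) * Complex.exp ((β : ℂ) * I))‖⁻¹ := by
  have hr : 0 < ‖w‖ := norm_pos_iff.mpr hw0
  rcases le_or_gt 0 w.im with him | him
  · -- upper half-plane: w = ((‖w‖ : ℂ) * Complex.exp (((arg w) : ℂ) * I)), arg w ∈ [0, π]
    have hα0 : 0 ≤ arg w := Complex.arg_nonneg_iff.mpr him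
    have hαπ : arg w ≤ π := Complex.arg_le_pi w
    have habs : |arg w| = arg w := abs_of_nonneg hα0
    have hw' : 1 + ((‖w‖ : ℂ) * Complex.exp (((arg w) : ℂ) * I)) ≠ 0 := by rwa [Complex.norm_mul_exp_arg_mul_I]
    have h := norm_truncBinom_sub_cpow_le_arc_geom M hM hr hα0 hαπ hw'
    rw [Complex.norm_mul_exp_arg_mul_I] at h
    rwa [habs]
  · -- lower half-plane: conjugate
    set w' : ℂ := conj w with hw'def
    have him' : 0 ≤ w'.im := by rw [hw'def, Complex.conj_im]; linarith
    have hnorm' : ‖w'‖ = ‖w‖ := by rw [hw'def, Complex.norm_conj]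
    have hargw : arg w < 0 := Complex.arg_neg_iff.mpr him
    have harg' : arg w' = -arg w := by
      rw [hw'def, Complex.arg_conj]
      have : arg w ≠ π := by intro h; rw [h] at hargw; linarith [Real.pi_pos]
      simp [this]
    have habs : |arg w| = arg w' := by rw [harg', abs_of_neg hargw]
    have hα0 : 0 ≤ arg w' := Complex.arg_nonneg_iff.mpr him'
    have hαπ : arg w' ≤ π := Complex.arg_le_pi w'
    have hr' : 0 < ‖w'‖ := by rwa [hnorm']
    have h1w' : 1 + w' = conj (1 + w) := by rw [hw'def, map_add, map_one]
    have hw1' : 1 + w' ≠ 0 := by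
      rw [h1w']; exact (map_ne_zero_iff _ (RingHom.injective _)).mpr hw1
    have hw'' : 1 + ((‖w'‖ : ℂ) * Complex.exp (((arg w') : ℂ) * I)) ≠ 0 := by rwa [Complex.norm_mul_exp_arg_mul_I]
    have h := norm_truncBinom_sub_cpow_le_arc_geom M hM hr' hα0 hαπ hw''
    rw [Complex.norm_mul_exp_arg_mul_I] at h
    -- translate back to w
    have harg1 : (1 + w).arg ≠ π := by
      intro h1
      have : (1 + w).im = 0 := (Complex.arg_eq_pi_iff.mp h1).2
      simp at this; linarith
    have hconj : (∑ k ∈ Finset.range (M + 1), ((((descPochhammer ℝ k).eval ((M : ℝ) - 1 / 2) / (Nat.factorial k : ℝ)) : ℝ) : ℂ) * w' ^ k) - (1 + w') ^ ((((M : ℝ) - 1 / 2) : ℝ) : ℂ) =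
        conj ((∑ k ∈ Finset.range (M + 1), ((((descPochhammer ℝ k).eval ((M : ℝ) - 1 / 2) / (Nat.factorial k : ℝ)) : ℝ) : ℂ) * w ^ k) - (1 + w) ^ ((((M : ℝ) - 1 / 2) : ℝ) : ℂ)) := by
      rw [map_sub, ← truncBinom_conj, h1w', Complex.conj_cpow _ _ harg1, Complex.conj_ofReal]
    rw [hconj, Complex.norm_conj, h1w', Complex.norm_conj, hnorm'] at h
    rwa [habs]

end Summit.RiemannHypothesis.RiemannHypothesis.Theorems.JensenPolynomials.WindowEGF
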